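import Literature.AlgebraicGeometry.Frobenioids.CategoriesFactorization
import Literature.AlgebraicGeometry.Frobenioids.ElementaryFrobenioid
import Literature.AlgebraicGeometry.Frobenioids.DivisorMonoidExamples
import Literature.AlgebraicGeometry.Frobenioids.FiniteEtaleBase
import Literature.AlgebraicGeometry.Frobenioids.FinSubextCat
import Literature.AlgebraicGeometry.Frobenioids.PadicFrobenioidZero
import HarnessLib

/-!
# Non-vacuity of six `Hom` structures of the Frobenioid files (L1 inhabitation census)

Mochizuki, *The geometry of Frobenioids I*, Kyushu J. Math. **62** (2008) [FrdI], §0 p. 17 (categorical fiber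
products), Def. 1.1 (iii) (the elementary Frobenioid `F_Φ`), Ex. 4.3 p. 82, Ex. 6.3 p. 113; *… II* [FrdII],
§1 p. 7 (the base categories `D₀`), Ex. 1.1 (i) p. 7 (`p`-adic Frobenioids).
[cite: MochizukiFrdI2008, §0 p.17] [cite: MochizukiFrdI2008, Def. 1.1(iii)] [cite: MochizukiFrdI2008, Ex. 4.3 p.82]
[cite: MochizukiFrdI2008, Ex. 6.3 p.113] [cite: MochizukiFrdII2008, §1 p.7] [cite: MochizukiFrdII2008, Ex 1.1 (i) p.7]

PROOF-ONLY companion (abc-iut cell; writer abc-iut-w6-d050, an L3 seat serving the L1 NODES NV column by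
signature).  abc-iut-w5-d197's kernel INHABITATION-CENSUS-L1 v5 (09:45Z) has 82/88 structures witnessed; the six
remaining rows are ALL hom-structures of categories — `CFP.Hom`, `ElemFrobenioid.Hom`, `Ex43.Hom`, `FinEtale.Hom`,
`FinSubextCat.Hom`, `PadicFrd.PadicFld.Hom` — whose inhabitants in the tree are `Category`-instance fields and
`X ⟶ Y`-typed terms, invisible to a by-name scan.  Below, per structure: the identity typed BY NAME, the bridge
from any arrow `X ⟶ Y`, and, where the interface carries one, an honest content witness (the exact existence
criterion for `ElemFrobenioid.Hom`; order-theoretic existence / emptiness / non-identity-endomorphism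
criteria for `Ex43.Hom`; the structure map to `Spec F` for `FinEtale.Hom`; inclusion-induced morphisms and the
map to `Spec F` for `FinSubextCat.Hom`).  No `def`, no `instance`, no new named fact; nothing here bears on
[IUTchIII] Cor. 3.12.
-/

namespace Literature.AlgebraicGeometry.Frobenioids

open CategoryTheory Opposite

universe w v v₁ v₂ v₃ u u₁ u₂ u₃

/-! ### §1 `CFP.Hom` ([FrdI] §0 p. 17: morphisms of the categorical fiber product `C₁ ×_D C₂`) -/

namespace CFP

variable {C₁ : Type u₁} [Category.{v₁} C₁] {C₂ : Type u₂} [Category.{v₂} C₂] {D : Type u₃}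
  [Category.{v₃} D] {Φ₁ : C₁ ⥤ D} {Φ₂ : C₂ ⥤ D}

/-- `CFP.Hom` is inhabited at every object: the identity pair, typed by name.
[cite: MochizukiFrdI2008, §0 p.17] -/
theorem Hom.nonempty_self (X : CFP Φ₁ Φ₂) : Nonempty (Hom X X) :=
  ⟨𝟙 X⟩

/-- Every arrow of `C₁ ×_D C₂` is a `CFP.Hom` (bridge for by-name scans). [cite: MochizukiFrdI2008, §0 p.17] -/
theorem Hom.nonempty_of_hom {X Y : CFP Φ₁ Φ₂} (f : X ⟶ Y) : Nonempty (Hom X Y) :=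
  ⟨f⟩

/-- `CFP.Hom`s compose. [cite: MochizukiFrdI2008, §0 p.17] -/
theorem Hom.nonempty_comp {X Y Z : CFP Φ₁ Φ₂} (h₁ : Nonempty (Hom X Y)) (h₂ : Nonempty (Hom Y Z)) :
    Nonempty (Hom X Z) := by
  obtain ⟨f⟩ := h₁
  obtain ⟨g⟩ := h₂
  exact ⟨CategoryStruct.comp (X := X) (Y := Y) (Z := Z) f g⟩

end CFP

/-! ### §2 `ElemFrobenioid.Hom` ([FrdI] Def. 1.1 (iii): triples `(Base(φ), Div(φ), deg_Fr(φ))`) -/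

namespace ElemFrobenioid

variable {D : Type u} [Category.{v} D] {Φ : Dᵒᵖ ⥤ CommMonCat.{w}}

/-- **Exact existence criterion**: `F_Φ` has a morphism `A → B` iff the base category has a morphism
`Base(A) → Base(B)` (then `(f, 0, 1)` is one). [cite: MochizukiFrdI2008, Def. 1.1(iii)] -/
theorem Hom.nonempty_iff (A B : ElemFrobenioid Φ) : Nonempty (Hom A B) ↔ Nonempty (A.base ⟶ B.base) :=
  ⟨fun ⟨φ⟩ => ⟨φ.base⟩, fun ⟨f⟩ => ⟨⟨f, 1, 1⟩⟩⟩

/-- Endomorphisms of `A` with PRESCRIBED zero divisor and Frobenius degree over the identity of `Base(A)`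
(e.g. the "Frobenius" `(id, 0, n)` and the "divisor" morphisms `(id, Z, 1)`).
[cite: MochizukiFrdI2008, Def. 1.1(iii)] -/
theorem Hom.exists_base_id (A : ElemFrobenioid Φ) (Z : Φ.obj (op A.base)) (n : ℕ+) :
    ∃ φ : Hom A A, φ.base = 𝟙 A.base ∧ φ.div = Z ∧ φ.degFr = n :=
  ⟨⟨𝟙 _, Z, n⟩, rfl, rfl, rfl⟩

/-- `ElemFrobenioid.Hom` is inhabited at every object: the identity `(id, 0, 1)`, typed by name.
[cite: MochizukiFrdI2008, Def. 1.1(iii)] -/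
theorem Hom.nonempty_self (A : ElemFrobenioid Φ) : Nonempty (Hom A A) :=
  ⟨𝟙 A⟩

/-- Every arrow of `F_Φ` is an `ElemFrobenioid.Hom` (bridge). [cite: MochizukiFrdI2008, Def. 1.1(iii)] -/
theorem Hom.nonempty_of_hom {A B : ElemFrobenioid Φ} (φ : A ⟶ B) : Nonempty (Hom A B) :=
  ⟨φ⟩

end ElemFrobenioid

/-! ### §3 `Ex43.Hom` ([FrdI] Ex. 4.3 p. 82: `d ∈ ℕ_{≥1}` with `d · a ≤ b`) -/

namespace Ex43

/-- `Ex43.Hom` is inhabited at every object: the identity (`d = 1`), typed by name.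
[cite: MochizukiFrdI2008, Ex. 4.3 p.82] -/
theorem Hom.nonempty_self (a : Obj) : Nonempty (Hom a a) :=
  ⟨𝟙 a⟩

/-- Every arrow of the category of Ex. 4.3 is an `Ex43.Hom` (bridge). [cite: MochizukiFrdI2008, Ex. 4.3 p.82] -/
theorem Hom.nonempty_of_hom {a b : Obj} (f : a ⟶ b) : Nonempty (Hom a b) :=
  ⟨f⟩

/-- A morphism `a → b` of degree `1` exists as soon as `a ≤ b`. [cite: MochizukiFrdI2008, Ex. 4.3 p.82] -/
theorem Hom.nonempty_of_le {a b : Obj} (h : a.val ≤ b.val) : Nonempty (Hom a b) :=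
  ⟨⟨1, by simpa using h⟩⟩

/-- **Empty hom-sets**: for `a ≥ 0` and `b < a` there is NO morphism `a → b` (every degree `d ≥ 1` gives
`d · a ≥ a > b`). [cite: MochizukiFrdI2008, Ex. 4.3 p.82] -/
theorem Hom.isEmpty_of_lt {a b : Obj} (ha : 0 ≤ a.val) (h : b.val < a.val) : IsEmpty (Hom a b) :=
  ⟨fun f => by
    have h1 : (1 : ℚ) ≤ (f.deg : ℚ) := by exact_mod_cast (one_le (a := f.deg))
    have hle := f.le
    nlinarith⟩

/-- Concretely: no morphism `1 → 0`, but a morphism `0 → 1`. [cite: MochizukiFrdI2008, Ex. 4.3 p.82] -/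
theorem Hom.isEmpty_one_zero_and_nonempty_zero_one :
    IsEmpty (Hom ⟨1⟩ ⟨0⟩) ∧ Nonempty (Hom ⟨0⟩ ⟨1⟩) :=
  ⟨Hom.isEmpty_of_lt (by norm_num) (by norm_num), Hom.nonempty_of_le (by norm_num)⟩

/-- **Non-identity endomorphisms**: `a` has an endomorphism of Frobenius degree `≠ 1` iff `a ≤ 0`
(`d · a ≤ a` with `d ≥ 2` forces `a ≤ 0`; conversely `2 · a ≤ a` for `a ≤ 0`).
[cite: MochizukiFrdI2008, Ex. 4.3 p.82] -/
theorem Hom.exists_deg_ne_one_iff (a : Obj) : (∃ f : Hom a a, f.deg ≠ 1) ↔ a.val ≤ 0 := by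
  constructor
  · rintro ⟨f, hf⟩
    have h1 : 1 < f.deg := lt_of_le_of_ne (one_le (a := f.deg)) (Ne.symm hf)
    have h1' : (1 : ℚ) < (f.deg : ℚ) := by exact_mod_cast h1
    have hle := f.le
    by_contra hpos
    rw [not_le] at hpos
    nlinarith
  · intro ha
    refine ⟨⟨⟨2, by norm_num⟩, ?_⟩, fun h => ?_⟩
    · simp only [PNat.mk_coe, Nat.cast_ofNat]
      linarith
    · have h' := congrArg PNat.val h
      simp at h'

end Ex43

/-! ### §4 `FinEtale.Hom` ([FrdII] §1 p. 7: `F`-algebra maps in the opposite direction) -/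

namespace FinEtale

variable {F : Type u} [Field F]

/-- `FinEtale.Hom` is inhabited at every object: the identity, typed by name. [cite: MochizukiFrdII2008, §1 p.7] -/
theorem Hom.nonempty_self (X : FinEtale F) : Nonempty (Hom X X) :=
  ⟨𝟙 X⟩

/-- Every arrow of `D₀ = FinEtale F` is a `FinEtale.Hom` (bridge). [cite: MochizukiFrdII2008, §1 p.7] -/
theorem Hom.nonempty_of_hom {X Y : FinEtale F} (f : X ⟶ Y) : Nonempty (Hom X Y) :=
  ⟨f⟩

/-- **The structure morphism** `Spec K → Spec F`: a NON-identity witness from every object to the final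
object `base F`. [cite: MochizukiFrdII2008, §1 p.7] -/
theorem Hom.nonempty_to_base (X : FinEtale F) : Nonempty (Hom X (base F)) :=
  ⟨toBase X⟩

end FinEtale

/-! ### §5 `FinSubextCat.Hom` ([FrdI] Ex. 6.3 p. 113: `F`-algebra maps `M → L` for `Spec L → Spec M`) -/

namespace FinSubextCat

variable {F : Type u} [Field F] {K : Type u} [Field K] [Algebra F K]

/-- `FinSubextCat.Hom` is inhabited at every object: the identity, typed by name.
[cite: MochizukiFrdI2008, Ex. 6.3 p.113] -/
theorem Hom.nonempty_self (X : FinSubextCat F K) : Nonempty (Hom X X) :=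
  ⟨𝟙 X⟩

/-- Every arrow of `FinSubextCat F K` is a `FinSubextCat.Hom` (bridge). [cite: MochizukiFrdI2008, Ex. 6.3 p.113] -/
theorem Hom.nonempty_of_hom {X Y : FinSubextCat F K} (f : X ⟶ Y) : Nonempty (Hom X Y) :=
  ⟨f⟩

/-- **Inclusions of subextensions give morphisms**: if `M ⊆ L` inside `K` then `Spec L → Spec M` (the
inclusion `M ↪ L` as an `F`-algebra map). [cite: MochizukiFrdI2008, Ex. 6.3 p.113] -/
theorem Hom.nonempty_of_le {X Y : FinSubextCat F K} (h : Y.L ≤ X.L) : Nonempty (Hom X Y) :=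
  ⟨⟨IntermediateField.inclusion h⟩⟩

/-- **The structure morphism to `Spec F`** (the object `⟨⊥⟩`, `F` itself as the bottom intermediate field):
a witness from every object to a FIXED object. [cite: MochizukiFrdI2008, Ex. 6.3 p.113] -/
theorem Hom.nonempty_to_bot (X : FinSubextCat F K) :
    Nonempty (Hom X (FinSubextCat.mk (F := F) (K := K) ⊥)) :=
  Hom.nonempty_of_le bot_le

end FinSubextCat

/-! ### §6 `PadicFrd.PadicFld.Hom` ([FrdII] Ex. 1.1 (i): valuative ring maps in the opposite direction) -/

namespace PadicFrd.PadicFld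

variable {p : ℕ}

/-- `PadicFld.Hom` is inhabited at every object: the identity (a valuative homomorphism), typed by
name. [cite: MochizukiFrdII2008, Ex 1.1 (i) p.7] -/
theorem Hom.nonempty_self (X : PadicFld.{u} p) : Nonempty (Hom X X) :=
  ⟨𝟙 X⟩

/-- Every arrow of the base category of `p`-adic fields is a `PadicFld.Hom` (bridge).
[cite: MochizukiFrdII2008, Ex 1.1 (i) p.7] -/
theorem Hom.nonempty_of_hom {X Y : PadicFld.{u} p} (f : X ⟶ Y) : Nonempty (Hom X Y) :=
  ⟨f⟩

/-- `PadicFld.Hom`s compose (composites of valuative homomorphisms are valuative, `isValHom_comp`).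
[cite: MochizukiFrdII2008, Ex 1.1 (i) p.7] -/
theorem Hom.nonempty_comp {X Y Z : PadicFld.{u} p} (h₁ : Nonempty (Hom X Y)) (h₂ : Nonempty (Hom Y Z)) :
    Nonempty (Hom X Z) := by
  obtain ⟨f⟩ := h₁
  obtain ⟨g⟩ := h₂
  exact ⟨⟨f.alg.comp g.alg, isValHom_comp f g⟩⟩

end PadicFrd.PadicFld

end Literature.AlgebraicGeometry.Frobenioids
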